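import Summits.Ventures.HSemireg.WedgeHankelRecurrenceAffinePolar

/-!
# Venture HSemireg — EXTENSION BY ONE COEFFICIENT (the converse of truncation): reading a class of middle rank `R^N(q)` one coefficient further, **`R^{N+1}(q) ∈ {R^N(q), R^N(q) + 1}`, and
# the step is decided as follows — a class WITH a node at infinity always steps up (its polar part gains one order); a class WITHOUT one steps up iff the new coefficient `q_{N+1}` breaks
# the minimal recurrence `m` (one scalar condition `⟪m, q⟫_{N+1−d} ≠ 0`), and otherwise keeps rank and recurrence** — the transition rule behind every census table of the lineage

HONEST FRAMING. Part of the Lean index of the computation cell `pub-hsemireg` (seat p10 gen 27, Sunday typer «UNIFORM-IN-n»).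
LINEAR ALGEBRA OF HANKEL (catalecticant) MATRICES and of polynomials over a field ONLY: no variety, no cohomology theory, no sheaf, no Ext group and no semiregularity map is constructed
here; nothing here says that HC / HC_CM / HC_AV holds; no Literature fact is declared or used.  Custodian versions as in `WedgeHankelSiegelIdeal` (1/3); the dictionary (`R^N(q)` the middle
rank on `[0, N]`; «the new coefficient continues the recurrence» = `m ∈ Rec^{N+1}_d(q)`; Berlekamp–Massey's «discrepancy») is QUOTED, never asserted.

WHAT IS KEYED.  N34 (`WedgeHankelRecurrenceAffinePolar`, № 267): `rank_half_eq_and_mem_recSpace_iff_exists_affine_polar`, `rank_half_eq_and_mem_recSpace_iff_exists_affine`; N32 (№ 263):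
`dualSeq`, `mem_recSpace_dualSeq`; N33 (№ 264) `mem_recSpace_add_add_iff`; N23 (№ 176): `eq_of_monic_recurrence`, `hkFun_eq_zero_of_mem_recSpace`, `recSpace_congr`; N29 (№ 237)
`mem_recSpace_succ_succ_iff`; N18 (№ 173): `recSpace`, `mem_recSpace_iff`, `natDegree_le_of_mem_recSpace`, `mem_degreeLT_succ_iff`.  Mathlib: `Polynomial.monic_mul_leadingCoeff_inv`.
THIS FILE (namespace `Summit.Ventures.HSemireg.Wedge.HankelOuter` continued; CHAINED on N34; 0 definitions):
* §529 `mem_recSpace_succ_iff_hkFun_eq_zero` (`m ∈ Rec^N_d(q)`: `m ∈ Rec^{N+1}_d(q) ↔ ⟪m, q⟫_{N+1−d} = 0` — the one new condition, `d ≤ N + 1`), `exists_monic_mem_recSpace'` (normalisation).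
* §530 for `R^N(q) = d` with `0 ≠ m ∈ Rec^N_d(q)` of full degree `d` (no node at infinity), `2d ≤ N`: **`rank_half_succ_of_affine_of_mem`** (`m ∈ Rec^{N+1}_d(q) ⇒ R^{N+1}(q) = d`: the
  recurrence continues, nothing changes), **`rank_half_succ_of_affine_of_not_mem`** (`m ∉ Rec^{N+1}_d(q) ⇒ R^{N+1}(q) = d + 1` with `m ∈ Rec^{N+1}_{d+1}(q)`: a broken recurrence creates a
  simple node at infinity), `rank_half_succ_of_affine` (the dichotomy).
* §531 for `R^N(q) = d + e`, `e ≥ 1`, `0 ≠ m ∈ Rec^N_{d+e}(q)` of degree `d`, `2(d + e) ≤ N`: **`rank_half_succ_of_polar`** (`R^{N+1}(q) = d + e + 1` and `m ∈ Rec^{N+1}_{d+e+1}(q)`, WHATEVER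
  `q_{N+1}` is: the polar part gains one order), and the uniform bound **`rank_half_succ_le_succ`** (`R^N(q) ≤ R^{N+1}(q) ≤ R^N(q) + 1` for `2R^N(q) ≤ N`).
READING: N39 read the structure theorem downwards (truncation); this file reads it upwards: the extension rule «affine & continued ↦ same; affine & broken ↦ +1 with `e = 1`; polar ↦
+1» is exactly the transition that generates the rank profiles (N15–N17) coefficient by coefficient, and the counting rule behind the `F_s`-census (`1`, `s − 1`, `s` extensions
respectively).  Nothing Ext-side.  New names only.
-/

open Module Polynomial
open scoped Matrix Polynomial

namespace Summit.Ventures.HSemireg.Wedge.HankelOuter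

open Summit.Ventures.HSemireg.Wedge Summit.Ventures.HSemireg.Wedge.Hankel

variable (K : Type*) [Field K] {N : ℕ}

/-! ## §529. The one new recurrence condition -/

/-- **for `m ∈ Rec^N_d(q)` (and `d ≤ N + 1`), `m ∈ Rec^{N+1}_d(q) ↔ ⟪m, q⟫_{N+1−d} = 0`**: reading one more coefficient adds exactly one condition (the «discrepancy»). -/
theorem mem_recSpace_succ_iff_hkFun_eq_zero {d : ℕ} (hd : d ≤ N + 1) {q : ℕ → K} {m : K[X]} (hm : m ∈ recSpace K N q d) :
    m ∈ recSpace K (N + 1) q d ↔ hkFun K q (N + 1 - d) m = 0 := by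
  rw [mem_recSpace_iff] at hm ⊢
  constructor
  · intro h; exact h.2 _ (by omega)
  · intro h
    refine ⟨hm.1, fun s hs => ?_⟩
    rcases Nat.lt_or_ge s (N + 1 - d) with hlt | hge
    · exact hm.2 s (by omega)
    · rw [show s = N + 1 - d by omega]; exact h

/-- a non-zero recurrence normalises to a monic one of the same degree in the same spaces (both levels). -/
theorem exists_monic_mem_recSpace' {k : ℕ} {q : ℕ → K} {m : K[X]} (hm : m ∈ recSpace K N q k) (hm0 : m ≠ 0) :
    ∃ m₁ : K[X], m₁.Monic ∧ m₁.natDegree = m.natDegree ∧ m₁ ∈ recSpace K N q k ∧ (∀ M j, m ∈ recSpace K M q j ↔ m₁ ∈ recSpace K M q j) := by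
  have hlc : m.leadingCoeff ≠ 0 := Polynomial.leadingCoeff_ne_zero.mpr hm0
  have key : ∀ M j, m ∈ recSpace K M q j ↔ m * Polynomial.C (m.leadingCoeff)⁻¹ ∈ recSpace K M q j := by
    intro M j
    rw [mul_comm, Polynomial.C_mul']
    exact ⟨fun h => Submodule.smul_mem _ _ h, fun h => by
      have h' := Submodule.smul_mem _ (m.leadingCoeff) h
      rwa [smul_smul, mul_inv_cancel₀ hlc, one_smul] at h'⟩
  exact ⟨m * Polynomial.C (m.leadingCoeff)⁻¹, Polynomial.monic_mul_leadingCoeff_inv hm0, Polynomial.natDegree_mul_leadingCoeff_inv m hm0, (key N k).mp hm, key⟩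

/-! ## §530. A class without a node at infinity: the new coefficient either continues the recurrence or creates a simple node at infinity -/

section Affine

variable {d : ℕ} {q : ℕ → K} {m : K[X]}
  (hq : (hankel1 K N (N / 2) q).rank = d) (hm : m ∈ recSpace K N q d) (hm0 : m ≠ 0) (hmd : m.natDegree = d) (h2 : d + d ≤ N)
include hq hm hm0 hmd h2

/-- **THE RECURRENCE CONTINUES: `m ∈ Rec^{N+1}_d(q) ⇒ R^{N+1}(q) = d`** (`R^N(q) = d`, `m` of full degree `d`, `2d ≤ N`). -/
theorem rank_half_succ_of_affine_of_mem (hmem : m ∈ recSpace K (N + 1) q d) : (hankel1 K (N + 1) ((N + 1) / 2) q).rank = d := by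
  obtain ⟨m₁, hmo, hdeg, hm₁, hiff⟩ := exists_monic_mem_recSpace' K hm hm0
  rw [hmd] at hdeg
  obtain ⟨a, hcop, ha, h⟩ := (rank_half_eq_and_mem_recSpace_iff_exists_affine K (N := N) hmo (by rw [hdeg]; omega) q).mp ⟨by rw [hdeg]; exact hq, by rw [hdeg]; exact hm₁⟩
  -- `q` and `dualSeq m₁ a` satisfy the monic recurrence `m₁` on `[0, N + 1]` and agree on `[0, d)`
  have hm₁' : m₁ ∈ recSpace K (N + 1) q m₁.natDegree := by rw [hdeg]; exact (hiff (N + 1) d).mp hmem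
  have hagree : ∀ j ≤ N + 1, q j = dualSeq K m₁ a j :=
    eq_of_monic_recurrence K hmo rfl (hkFun_eq_zero_of_mem_recSpace K hm₁') (hkFun_eq_zero_of_mem_recSpace K (mem_recSpace_dualSeq K (N := N + 1) hmo a))
      fun j hj => h j (by omega)
  have key := (rank_half_eq_and_mem_recSpace_iff_exists_affine K (N := N + 1) hmo (by rw [hdeg]; omega) q).mpr ⟨a, hcop, ha, hagree⟩
  rw [hdeg] at key
  exact key.1

/-- **THE RECURRENCE BREAKS: `m ∉ Rec^{N+1}_d(q) ⇒ R^{N+1}(q) = d + 1` and `m ∈ Rec^{N+1}_{d+1}(q)`** — the new coefficient creates a simple node at infinity (a polar part of order `1`: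
`q_{N+1}` minus the predicted value). -/
theorem rank_half_succ_of_affine_of_not_mem (hmem : m ∉ recSpace K (N + 1) q d) :
    (hankel1 K (N + 1) ((N + 1) / 2) q).rank = d + 1 ∧ m ∈ recSpace K (N + 1) q (d + 1) := by
  refine ⟨?_, (mem_recSpace_succ_succ_iff K ((mem_degreeLT_succ_iff K).mpr hmd.le)).mpr hm⟩
  obtain ⟨m₁, hmo, hdeg, hm₁, hiff⟩ := exists_monic_mem_recSpace' K hm hm0
  rw [hmd] at hdeg
  obtain ⟨a, hcop, ha, h⟩ := (rank_half_eq_and_mem_recSpace_iff_exists_affine K (N := N) hmo (by rw [hdeg]; omega) q).mp ⟨by rw [hdeg]; exact hq, by rw [hdeg]; exact hm₁⟩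
  set u := dualSeq K m₁ a
  -- the discrepancy `q_{N+1} − u_{N+1}` is non-zero, else `q = u` on `[0, N + 1]` and `m` would still be a recurrence
  have hne : (q - u) (N + 1) ≠ 0 := by
    intro h0
    rw [Pi.sub_apply, sub_eq_zero] at h0
    have hagree : ∀ j ≤ N + 1, q j = u j := fun j hj => by
      rcases Nat.lt_or_ge j (N + 1) with hlt | hge
      · exact h j (by omega)
      · rw [show j = N + 1 by omega]; exact h0
    apply hmem
    rw [hiff (N + 1) d, recSpace_congr K hagree, ← hdeg]
    exact mem_recSpace_dualSeq K hmo a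
  have key := (rank_half_eq_and_mem_recSpace_iff_exists_affine_polar K (N := N + 1) hmo (e := 1) le_rfl (by rw [hdeg]; omega) q).mpr
    ⟨a, q - u, hcop, ha, fun j hj => by rw [Pi.sub_apply, h j (by omega), sub_self], by rw [show N + 1 + 1 - 1 = N + 1 by omega]; exact hne,
      fun j _ => by rw [Pi.sub_apply]; ring⟩
  rw [hdeg] at key
  exact key.1

/-- the dichotomy: **`R^{N+1}(q) = d` or `R^{N+1}(q) = d + 1`, according as the new coefficient continues the recurrence or not.** -/
theorem rank_half_succ_of_affine :
    (m ∈ recSpace K (N + 1) q d ∧ (hankel1 K (N + 1) ((N + 1) / 2) q).rank = d) ∨ (m ∉ recSpace K (N + 1) q d ∧ (hankel1 K (N + 1) ((N + 1) / 2) q).rank = d + 1) := by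
  by_cases hmem : m ∈ recSpace K (N + 1) q d
  · exact Or.inl ⟨hmem, rank_half_succ_of_affine_of_mem K hq hm hm0 hmd h2 hmem⟩
  · exact Or.inr ⟨hmem, (rank_half_succ_of_affine_of_not_mem K hq hm hm0 hmd h2 hmem).1⟩

end Affine

/-! ## §531. A class with a node at infinity always steps up; the uniform bound -/

/-- **A POLAR PART GAINS ONE ORDER: for `R^N(q) = d + e`, `e ≥ 1`, a non-zero recurrence `m` of degree `d` in the window and `2(d + e) ≤ N`, `R^{N+1}(q) = d + e + 1` and `m` stays a
recurrence in the window `d + e + 2` — whatever the new coefficient `q_{N+1}` is.** -/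
theorem rank_half_succ_of_polar {d e : ℕ} {q : ℕ → K} {m : K[X]} (he : 1 ≤ e) (hm0 : m ≠ 0) (hmd : m.natDegree = d)
    (hq : (hankel1 K N (N / 2) q).rank = d + e) (hm : m ∈ recSpace K N q (d + e)) (h2 : d + e + (d + e) ≤ N) :
    (hankel1 K (N + 1) ((N + 1) / 2) q).rank = d + e + 1 ∧ m ∈ recSpace K (N + 1) q (d + e + 1) := by
  refine ⟨?_, (mem_recSpace_succ_succ_iff K ((mem_degreeLT_succ_iff K).mpr (by omega))).mpr hm⟩
  obtain ⟨m₁, hmo, hdeg, hm₁, -⟩ := exists_monic_mem_recSpace' K hm hm0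
  rw [hmd] at hdeg
  obtain ⟨a, τ, hcop, ha, hτ, hτe, h⟩ := (rank_half_eq_and_mem_recSpace_iff_exists_affine_polar K (N := N) hmo he (by rw [hdeg]; omega) q).mp
    ⟨by rw [hdeg]; exact hq, by rw [hdeg]; exact hm₁⟩
  set u := dualSeq K m₁ a
  -- at level `N + 1` the tail `q − u` has order `e + 1`, its lowest admissible coefficient is the old `τ_{N+1−e} ≠ 0`
  have key := (rank_half_eq_and_mem_recSpace_iff_exists_affine_polar K (N := N + 1) hmo (e := e + 1) (by omega) (by rw [hdeg]; omega) q).mpr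
    ⟨a, q - u, hcop, ha, fun j hj => by rw [Pi.sub_apply, h j (by omega), hτ j (by omega), add_sub_cancel_left],
      by rw [show N + 1 + 1 - (e + 1) = N + 1 - e by omega, Pi.sub_apply, h (N + 1 - e) (by omega), add_sub_cancel_left]; exact hτe,
      fun j _ => by rw [Pi.sub_apply]; ring⟩
  rw [hdeg] at key
  exact key.1

/-- **ONE MORE COEFFICIENT RAISES THE MIDDLE RANK BY AT MOST ONE AND NEVER LOWERS IT: `R^N(q) ≤ R^{N+1}(q) ≤ R^N(q) + 1`** (for `2R^N(q) ≤ N`). -/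
theorem rank_half_succ_le_succ {q : ℕ → K} (h2 : (hankel1 K N (N / 2) q).rank + (hankel1 K N (N / 2) q).rank ≤ N) :
    (hankel1 K N (N / 2) q).rank ≤ (hankel1 K (N + 1) ((N + 1) / 2) q).rank ∧ (hankel1 K (N + 1) ((N + 1) / 2) q).rank ≤ (hankel1 K N (N / 2) q).rank + 1 := by
  set r := (hankel1 K N (N / 2) q).rank with hr
  obtain ⟨m, hm0, hspan⟩ := exists_recSpace_self_eq_span K hr.symm (by omega)
  have hm : m ∈ recSpace K N q r := by rw [hspan]; exact Submodule.mem_span_singleton_self m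
  have hmr : m.natDegree ≤ r := natDegree_le_of_mem_recSpace K hm
  obtain ⟨e, he⟩ := Nat.exists_eq_add_of_le hmr
  rcases Nat.eq_zero_or_pos e with h0 | hpos
  · -- no node at infinity: `r` or `r + 1`
    rw [h0, add_zero] at he
    rcases rank_half_succ_of_affine K hr.symm hm hm0 he.symm (by omega) with ⟨-, h⟩ | ⟨-, h⟩
    · rw [h]; omega
    · rw [h]; omega
  · -- a node at infinity: exactly `r + 1`
    have hq' : (hankel1 K N (N / 2) q).rank = m.natDegree + e := by rw [← hr, he]
    have hm' : m ∈ recSpace K N q (m.natDegree + e) := by rw [← he]; exact hm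
    have h := (rank_half_succ_of_polar K hpos hm0 rfl hq' hm' (by omega)).1
    rw [h]; omega

end Summit.Ventures.HSemireg.Wedge.HankelOuter
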